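import Summits.Ventures.QEC.CircuitDistance.ETowerIdentX
import Summits.Ventures.QEC.CircuitDistance.ETowerTop
import HarnessLib

/-!
# P3-PORT STEP 2 (E-fold tower), sector X: SOUNDNESS OF THE K-FILE CONTINUATIONS `ktop / nodeC / nodeB / nodeA` and of the
# WINDOW scheme (ASSEMBLY-SPEC §B6, §B7; cell `qec`, experiment CDX, seat qec-cdx-type-1)

Over eng-1's `ETowerKX` (prototype shapes: `ktop = ktopG …`, `nodeC = nodeGdG …` by `rfl`) and the identities of `ETowerIdentX`:
the nested predicates `QT` (top), `NC`, `NB` and the facts the composed tower `kc_of_tower` consumes —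
`hktopX`, `hkCX` (given the weight-3 classes `W3C` certified: `hW3`), `hkBX`, `hkAX`, the closures `hNCX / hNBX`, and
`hW3_of_winsX`: the 4 × 8 window facts (eng-1's `ETowerWinX*`: `nodeCW (W3L.getD k []) (W3WIN3.getD j (0,0)) = true`) give `hW3`
(cover / bounds / `W3C = W3L.map maskOf` decided here).  No `native_decide`; nothing here asserts a value of `d_circ`.
-/

set_option maxRecDepth 100000
set_option exponentiation.threshold 1024

namespace Summit.Ventures.QEC.CircuitDistance.ETower.SecX

open Summit.Ventures.QEC.Census Summit.Ventures.QEC.Census.Fold Summit.Ventures.QEC.CircuitDistance.ETower K2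

/-! ## The nested predicates -/

/-- TOP predicate of sector X: kernel word ⇒ all logical parities (record `lg`) vanish, or an anchored translate is in `TOPS`. -/
def QT : ℕ → Prop := QTop 12 6 5 col0 lgR TOPS
/-- level-C fibre property of a 180-slot word of E₁. -/
def NC : ℕ → Prop := GoodFibK GC 5 col0 9 QT
/-- level-B fibre property of a 90-slot word of E₂. -/
def NB : ℕ → Prop := GoodFibK GB 5 col1 9 NC

/-- `QT` is closed under un-translating. -/
theorem hQTX : ∀ da db u, QT (transWK GC.l GC.m 5 da db u) → QT u := hQT TOPS
/-- `NC` is closed under un-translating (small torus of C = big torus of B). -/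
theorem hNCX : ∀ da db v, NC (transWK GB.l GB.m 5 da db v) → NC v :=
  fun da db v h => goodFibK_transWK_closed (G := GC) SecZ.shapeC SecZ.okC hK0 hQTX da db v h
/-- `NB` is closed under un-translating. -/
theorem hNBX : ∀ da db v, NB (transWK GA.l GA.m 5 da db v) → NB v :=
  fun da db v h => goodFibK_transWK_closed (G := GB) SecZ.shapeB SecZ.okB hK1 hNCX da db v h

/-! ## The logical table of the K file is the record's -/

/-- KERNEL: record `lg` = sector-X `TLG` on all 360 slots. -/
theorem lgR_eq_tlgX : ((List.range 360).all fun J => lgR J == tab TLG 12 J) = true := by decide +kernel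
/-- unpacked (window written `360`). -/
theorem hTLGX : ∀ J, J < 360 → tab TLG 12 J = lgR J := fun J hJ => by
  have := List.all_eq_true.1 lgR_eq_tlgX J (List.mem_range.2 hJ); rw [beq_iff_eq] at this; exact this.symm

/-! ## Soundness of the continuations -/

/-- **`ktop` soundness.** -/
theorem hktopX : ∀ S, (∀ J ∈ S, J < nK GC 5) → S.length = popc (nK GC 5) (maskOf S) → ktop S = true → QT (maskOf S) := by
  intro S hS _ h
  change ktopG 12 6 (fun j => tab TLG 12 j) md0 TOPS S = true at h
  exact ktopG_sound (nb := 5) (syn := col0) hTLGX hS h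

/-- **`nodeC` soundness**, given the weight-3 classes certified. -/
theorem hkCX (hW3 : ∀ r ∈ W3C, NC r) : ∀ S, (∀ j ∈ S, j < nsK GC 5) → nodeC S = true → NC (maskOf S) := by
  intro S hS h
  change nodeGdG GC 180 (tab TFC 72) (tab TPC 72) 9 ktop (fun S => decide (S.length ≤ 3)) md0 W3C S = true at h
  exact nodeGdG_sound (G := GC) SecZ.shapeC SecZ.okC hK0 hMC hMpC hQTX hktopX hW3 hS h

/-- **`nodeB` soundness.** -/
theorem hkBX (hW3 : ∀ r ∈ W3C, NC r) : ∀ S, (∀ j ∈ S, j < nsK GB 5) → nodeB S = true → NB (maskOf S) := by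
  intro S hS h
  exact nodeK_sound (G := GB) SecZ.shapeB SecZ.okB (hK1 GB.gen.1 GB.gen.2) hMB hMpB (hNCX GB.gen.1 GB.gen.2) (fun S' hS' _ h' => hkCX hW3 S' hS' h') hS h

/-- **`nodeA` soundness.** -/
theorem hkAX (hW3 : ∀ r ∈ W3C, NC r) : ∀ S, (∀ j ∈ S, j < nsK GA 5) → nodeA S = true → GoodFibK GA 5 col2 9 NB (maskOf S) := by
  intro S hS h
  exact nodeK_sound (G := GA) SecZ.shapeA SecZ.okA (hK2 GA.gen.1 GA.gen.2) hMA hMpA (hNBX GA.gen.1 GA.gen.2) (fun S' hS' _ h' => hkBX hW3 S' hS' h') hS h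

/-! ## The windows give the weight-3 classes -/

/-- KERNEL: `W3C` lists exactly the masks of `W3L`, the window family has a window starting at 0, and it covers every
outside position of every `W3L` word (words inside the window). -/
theorem winCoverX :
    (decide (W3C = W3L.map maskOf) &&
     decide (∃ w ∈ W3WIN3, w.1 = 0) &&
     (W3L.all fun L => (L.all fun j => decide (j < 180)) &&
       (List.range (outsideOf 180 (bitsOf 180 0 (maskOf L))).length).all fun p =>
         W3WIN3.any fun w => decide (w.1 ≤ p) && decide (p < w.2))) = true := by
  decide +kernel

/-- **The 4 × 8 window facts certify the weight-3 classes**: `hW3`. -/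
theorem hW3_of_winsX (hwin : ∀ L ∈ W3L, ∀ w ∈ W3WIN3, nodeCW L w = true) : ∀ r ∈ W3C, NC r := by
  have h := winCoverX
  rw [Bool.and_eq_true, Bool.and_eq_true, decide_eq_true_eq, decide_eq_true_eq, List.all_eq_true] at h
  obtain ⟨⟨hW3C, hzero⟩, hall⟩ := h
  intro r hr
  rw [hW3C, List.mem_map] at hr
  obtain ⟨L, hL, rfl⟩ := hr
  have hLall := hall L hL
  rw [Bool.and_eq_true, List.all_eq_true, List.all_eq_true] at hLall
  obtain ⟨hbnd, hcov⟩ := hLall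
  have hSb : ∀ j ∈ L, j < nsK GC 5 := fun j hj => by
    have := hbnd j hj; rw [decide_eq_true_eq] at this; exact lt_of_lt_of_eq this (by decide)
  refine nodeKW_sound (G := GC) SecZ.okC hMC hMpC (k := ktop) (Q := QT) hktopX hSb W3WIN3 hzero ?_ ?_
  · intro p hp
    have hp' : p < (outsideOf 180 (bitsOf 180 0 (maskOf L))).length := by
      have e : nsK GC 5 = 180 := by decide
      rwa [e] at hp
    have := hcov p (List.mem_range.2 hp')
    rw [List.any_eq_true] at this
    obtain ⟨w, hw, hw'⟩ := this
    rw [Bool.and_eq_true, decide_eq_true_eq, decide_eq_true_eq] at hw'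
    exact ⟨w, hw, hw'.1, hw'.2⟩
  · intro w hw
    exact hwin L hL w hw

end Summit.Ventures.QEC.CircuitDistance.ETower.SecX
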